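import Summits.FinalStateConjecture.FinalStateConjecture.Theorems.SwallowTheDatumSubdataDevelopmentsEmbedRealise
import HarnessLib

/-!
# Crux `CaptureSufficesC2` (stmt-FinalStateConjecture-14986), line `Sketch` — stub
# `stub_hypersurfaceMGHDRealised`, part 1: realising a development inside another one over a map
# into a spacetime

Helper for the hypersurface sub-data maximality stub (see
`…PhaseMixingCaptureCaptureSufficesC2StubHypersurfaceMGHDRealised.lean`): the version of
`SubdataDevelopmentsEmbed.exists_realised_rel` (item 10053) in which the second development is
replaced by a SPACETIME `𝒮₂` and the composite `ι₂ ∘ Φ` by an arbitrary map `ι₂ : N → 𝒮₂` — the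
shape needed when the sub-datum lives on a hypersurface `j : N → 𝓜` that is not a portion of the
data hypersurface of `𝓜`. Given embeddings `j : 𝒰 → 𝒟₁` (of developments) and `k : 𝒰 → 𝒮₂`
(smooth isometric time-orientation preserving immersion, injective, `k ∘ ι_𝒰 = ι₂`), the pair
`(U, ψ) = (j(𝒰), k ∘ j⁻¹)` satisfies the seven displayed conjuncts of a realised common
sub-development over `ι₂`, with `U = j(𝒰)`, `ψ` injective on `U` and `ψ ∘ j = k`
(Sbierski 2016, §2, Remark (2) after Def. 2.4). Proof transcribed from `exists_realised_rel`.
No definitions, no named facts.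
-/

noncomputable section

set_option linter.dupNamespace false

open Function Set Filter Topology TopologicalSpace Bundle
open scoped Manifold ContDiff Topology

namespace Summit.FinalStateConjecture.FinalStateConjecture.Theorems.CaptureSufficesC2.Sketch

open Literature.Geometry.Lorentzian
open Summit.FinalStateConjecture.FinalStateConjecture.Theorems.SubdataDevelopmentsEmbed

universe u

variable {n : ℕ}
  {N : Type u} [TopologicalSpace N] [ChartedSpace (EuclideanSpace ℝ (Fin n)) N]
  [IsManifold (𝓡 n) ∞ N] [ConnectedSpace N] {D₁ : InitialDataSet (𝓡 n) N}

/-! ### Realising a development inside another one, over a map into a spacetime -/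

/-- **Realising a development `𝒰` of the datum inside a development `𝒟₁` of the datum, as a
common sub-development of `𝒟₁` and a SPACETIME `𝒮₂` over a map `ι₂ : N → 𝒮₂`** (Sbierski 2016,
§2, Remark (2) after Def. 2.4, with explicit witnesses; the version of `exists_realised_rel` in
which the second development is replaced by a spacetime and `ι₂ ∘ Φ` by an arbitrary map `ι₂`):
if `j : 𝒰 → 𝒟₁` is a smooth, time-orientation preserving, isometric open embedding with
`j ∘ ι_𝒰 = ι₁` and `k : 𝒰 → 𝒮₂` a smooth, time-orientation preserving isometric immersion with
`k ∘ ι_𝒰 = ι₂`, then `(U, ψ) = (j(𝒰), k ∘ j⁻¹)` satisfies the seven displayed conjuncts of a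
common sub-development over `ι₂`, `U = j(𝒰)` and `ψ ∘ j = k`. The proof is that of
`exists_realised_rel`, verbatim. [cite: Sbierski2016AHP, §2, Def. 2.4 and Remark (2)] -/
theorem exists_realised_into (𝒰 𝒟₁ : CauchyDevelopment D₁) (𝒮₂ : Spacetime.{u} (n + 1))
    (ι₂ : N → 𝒮₂.carrier) {j : 𝒰.carrier → 𝒟₁.carrier}
    (hjs : ContMDiff (𝓡 (n + 1)) (𝓡 (n + 1)) ∞ j) (hjo : IsOpenEmbedding j)
    (hji : 𝒰.metric.IsIsometricImmersion 𝒟₁.metric.toPseudoRiemannianMetric j)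
    (hjt : 𝒰.timeOrientation.PreservesTimeOrientation j 𝒟₁.timeOrientation)
    (hjc : j ∘ 𝒰.embed = 𝒟₁.embed)
    {k : 𝒰.carrier → 𝒮₂.carrier} (hks : ContMDiff (𝓡 (n + 1)) (𝓡 (n + 1)) ∞ k)
    (hki : 𝒰.metric.IsIsometricImmersion 𝒮₂.metric.toPseudoRiemannianMetric k)
    (hkt : 𝒰.timeOrientation.PreservesTimeOrientation k 𝒮₂.timeOrientation)
    (hkc : k ∘ 𝒰.embed = ι₂) (hkinj : Injective k) :
    ∃ (U : Opens 𝒟₁.carrier) (ψ : 𝒟₁.carrier → 𝒮₂.carrier),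
      ((∀ u, 𝒟₁.embed u ∈ U) ∧ IsConnected (U : Set 𝒟₁.carrier) ∧
      (𝒟₁.metric.restrict PseudoRiemannianMetric.contMDiff_restrict_holds U).IsCauchyHypersurface
        (𝒟₁.timeOrientation.restrict PseudoRiemannianMetric.contMDiff_restrict_holds
          𝒟₁.timeOrientation.contMDiff_restrict_holds U) (Subtype.val ⁻¹' range 𝒟₁.embed) ∧
      ContMDiffOn (𝓡 (n + 1)) (𝓡 (n + 1)) ∞ ψ U ∧
      (∀ p ∈ U, pullbackBilin (I := 𝓡 (n + 1)) (I' := 𝓡 (n + 1)) ψ 𝒮₂.metric.val p =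
        𝒟₁.metric.val p) ∧
      (∀ p ∈ U, 𝒮₂.timeOrientation.IsFutureDirected
        (mfderiv (𝓡 (n + 1)) (𝓡 (n + 1)) ψ p (𝒟₁.timeOrientation.vectorField p))) ∧
      ψ ∘ 𝒟₁.embed = ι₂) ∧
      (U : Set 𝒟₁.carrier) = range j ∧ InjOn ψ U ∧ ∀ x, ψ (j x) = k x := by
  classical
  haveI : Nonempty 𝒰.carrier := inferInstance
  have hkd : MDifferentiable (𝓡 (n + 1)) (𝓡 (n + 1)) k := hks.mdifferentiable (by simp)
  set ji : 𝒟₁.carrier → 𝒰.carrier := invFun j with hji_def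
  have hleft : ∀ x, ji (j x) = x := leftInverse_invFun hjo.injective
  have hright : ∀ p ∈ range j, j (ji p) = p := fun p hp ↦ invFun_eq hp
  have hjis : ContMDiffOn (𝓡 (n + 1)) (𝓡 (n + 1)) ∞ ji (range j) :=
    contMDiffOn_invFun_range (𝒮 := 𝒰.toSpacetime) (𝒮' := 𝒟₁.toSpacetime) hji hjo.injective
  have hjid : ∀ p ∈ range j, MDifferentiableAt (𝓡 (n + 1)) (𝓡 (n + 1)) ji p := fun p hp ↦
    ((hjis p hp).contMDiffAt (hjo.isOpen_range.mem_nhds hp)).mdifferentiableAt (by simp)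
  -- `dj (dj⁻¹ w) = w` on the range
  have hdd : ∀ (x : 𝒰.carrier) (w : TangentSpace (𝓡 (n + 1)) (j x)),
      mfderiv (𝓡 (n + 1)) (𝓡 (n + 1)) j (ji (j x)) (mfderiv (𝓡 (n + 1)) (𝓡 (n + 1)) ji (j x) w)
        = w :=
    mfderiv_comp_mfderiv_invFun (𝒮 := 𝒰.toSpacetime) (𝒮' := 𝒟₁.toSpacetime) hji hjo.injective hjo
  -- scalar products: `g_𝒰 (dj⁻¹ v, dj⁻¹ w) = g₁ (v, w)` at points `j x`
  have hval : ∀ (x : 𝒰.carrier) (v w : TangentSpace (𝓡 (n + 1)) (j x)),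
      𝒰.metric.val (ji (j x)) (mfderiv (𝓡 (n + 1)) (𝓡 (n + 1)) ji (j x) v)
        (mfderiv (𝓡 (n + 1)) (𝓡 (n + 1)) ji (j x) w) = 𝒟₁.metric.val (j x) v w := by
    intro x v w
    have h := congrArg (fun b ↦ b (mfderiv (𝓡 (n + 1)) (𝓡 (n + 1)) ji (j x) v)
      (mfderiv (𝓡 (n + 1)) (𝓡 (n + 1)) ji (j x) w)) (hji.2 (ji (j x)))
    simp only [pullbackBilin_apply] at h
    rw [hdd, hdd] at h
    rw [hleft] at h ⊢
    exact h.symm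
  -- future-directed vectors: `dj⁻¹ v` is future-directed if `v` is (converse timecone lemma)
  have hfut : ∀ (x : 𝒰.carrier) (v : TangentSpace (𝓡 (n + 1)) (j x)),
      𝒟₁.timeOrientation.IsFutureDirected v →
        𝒰.timeOrientation.IsFutureDirected (mfderiv (𝓡 (n + 1)) (𝓡 (n + 1)) ji (j x) v) := by
    intro x v hv
    refine hjt.isFutureDirected_of_mfderiv hji.2 ?_
    rw [hdd]
    rw [hleft]
    exact hv
  refine ⟨⟨range j, hjo.isOpen_range⟩, k ∘ ji, ⟨fun u ↦ ?_, ?_, ?_, ?_, ?_, ?_, ?_⟩, rfl,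
    ?_, fun x ↦ ?_⟩
  · -- `ι₁ u = j (ι_𝒰 u) ∈ range j`
    exact ⟨𝒰.embed u, congrFun hjc u⟩
  · -- connected
    exact isConnected_range hjs.continuous
  · -- `ι₁(N)` is a Cauchy hypersurface of the sub-spacetime `range j`
    intro γ s hγ
    obtain ⟨hs, hγt, hγf, hγp⟩ := hγ
    have hγM : 𝒟₁.metric.IsFutureTimelikeCurveOn 𝒟₁.timeOrientation (Subtype.val ∘ γ) s :=
      (LorentzianMetric.isFutureTimelikeCurveOn_restrict_iff 𝒟₁.metric 𝒟₁.timeOrientation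
        PseudoRiemannianMetric.contMDiff_restrict_holds
        𝒟₁.timeOrientation.contMDiff_restrict_holds _).1 hγt
    -- the pulled-back curve in `𝒰`
    set δ : ℝ → 𝒰.carrier := fun t ↦ ji (γ t : 𝒟₁.carrier) with hδ_def
    have hjδ : ∀ t, j (δ t) = (γ t : 𝒟₁.carrier) := fun t ↦ hright _ (γ t).2
    have hδt : 𝒰.metric.IsFutureTimelikeCurveOn 𝒰.timeOrientation δ s := by
      intro t ht
      obtain ⟨hd, h1, h2⟩ := hγM t ht
      obtain ⟨x, hx⟩ := (γ t).2
      have hdδ : HasMFDerivAt 𝓘(ℝ, ℝ) (𝓡 (n + 1)) δ t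
          ((mfderiv (𝓡 (n + 1)) (𝓡 (n + 1)) ji (γ t : 𝒟₁.carrier)).comp
            (mfderiv 𝓘(ℝ, ℝ) (𝓡 (n + 1)) (Subtype.val ∘ γ) t)) :=
        (hjid _ (γ t).2).hasMFDerivAt.comp t hd.hasMFDerivAt
      have hvel : velocity (𝓡 (n + 1)) δ t =
          mfderiv (𝓡 (n + 1)) (𝓡 (n + 1)) ji (γ t : 𝒟₁.carrier)
            (velocity (𝓡 (n + 1)) (Subtype.val ∘ γ) t) := by
        simp only [velocity]; rw [hdδ.mfderiv]; rfl
      refine ⟨hdδ.mdifferentiableAt, ?_, ?_⟩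
      · -- timelike
        change 𝒰.metric.val (δ t) (velocity (𝓡 (n + 1)) δ t) (velocity (𝓡 (n + 1)) δ t) < 0
        rw [hvel]
        have hv := hval x
        rw [hx] at hv
        rw [show δ t = ji (γ t : 𝒟₁.carrier) from rfl, hv]
        exact h1
      · -- future-directed
        rw [hvel]
        have hf := hfut x
        rw [hx] at hf
        exact hf _ h2
    -- endlessness transported along the homeomorphism `j : 𝒰 ≅ range j`
    have hδf : IsFutureEndless δ s := by
      refine ⟨hγf.1, fun q hq ↦ hγf.2 ⟨j q, q, rfl⟩ ?_⟩
      have h1 : HasFutureEndpoint (j ∘ δ) s (j q) := (hjs.continuous.tendsto q).comp hq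
      have h2 : HasFutureEndpoint (Subtype.val ∘ γ) s (j q) := h1.congr fun t ↦ hjδ t
      exact hasFutureEndpoint_subtypeVal_comp_iff.1 h2
    have hδp : IsPastEndless δ s := by
      refine ⟨hγp.1, fun q hq ↦ hγp.2 ⟨j q, q, rfl⟩ ?_⟩
      have h1 : HasPastEndpoint (j ∘ δ) s (j q) := (hjs.continuous.tendsto q).comp hq
      have h2 : HasPastEndpoint (Subtype.val ∘ γ) s (j q) := h1.congr fun t ↦ hjδ t
      exact hasPastEndpoint_subtypeVal_comp_iff.1 h2
    -- `δ` meets `ι_𝒰(N)` exactly once; crossings correspond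
    obtain ⟨t₀, ⟨ht₀s, u₀, hu₀⟩, huniq⟩ := 𝒰.isCauchyHypersurface δ s ⟨hs, hδt, hδf, hδp⟩
    refine ⟨t₀, ⟨ht₀s, u₀, ?_⟩, fun t ht ↦ huniq t ⟨ht.1, ?_⟩⟩
    · -- `γ t₀ = j (δ t₀) = j (ι_𝒰 u₀) = ι₁ u₀`
      show 𝒟₁.embed u₀ = (γ t₀ : 𝒟₁.carrier)
      rw [← hjδ t₀, ← hu₀]; exact (congrFun hjc u₀).symm
    · obtain ⟨u, hu⟩ := ht.2
      refine ⟨u, ?_⟩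
      show 𝒰.embed u = ji (γ t : 𝒟₁.carrier)
      rw [← hu, show 𝒟₁.embed u = j (𝒰.embed u) from (congrFun hjc u).symm, hleft]
  · -- smooth on `range j`
    exact hks.comp_contMDiffOn hjis
  · -- isometric on `range j`
    rintro _ ⟨x, rfl⟩
    ext v w
    have hc := mfderiv_comp (j x) (hkd (ji (j x))) (hjid (j x) ⟨x, rfl⟩)
    have hk := congrArg (fun b ↦ b (mfderiv (𝓡 (n + 1)) (𝓡 (n + 1)) ji (j x) v)
      (mfderiv (𝓡 (n + 1)) (𝓡 (n + 1)) ji (j x) w)) (hki.2 (ji (j x)))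
    simp only [pullbackBilin_apply] at hk ⊢
    rw [hc]
    exact hk.trans (hval x v w)
  · -- time-orientation preserving on `range j`
    rintro _ ⟨x, rfl⟩
    rw [mfderiv_comp (j x) (hkd (ji (j x))) (hjid (j x) ⟨x, rfl⟩)]
    exact hkt.isFutureDirected_mfderiv hki.2
      (hfut x _ (𝒟₁.timeOrientation.isFutureDirected_vectorField (j x)))
  · -- `(k ∘ j⁻¹) ∘ ι₁ = k ∘ ι_𝒰 = ι₂`
    funext u
    show k (ji (𝒟₁.embed u)) = ι₂ u
    rw [show 𝒟₁.embed u = j (𝒰.embed u) from (congrFun hjc u).symm, hleft]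
    exact congrFun hkc u
  · -- injectivity of `k ∘ j⁻¹` on `range j`
    rintro _ ⟨x₁, rfl⟩ _ ⟨x₂, rfl⟩ h
    have h' : k x₁ = k x₂ := by simpa only [comp_apply, hleft] using h
    rw [hkinj h']
  · -- `ψ (j x) = k x`
    show k (ji (j x)) = k x
    rw [hleft]

/-- **Registered form** of `exists_realised_into` (dimension `3 + 1`, universe `0`): the sub-goal
`stub_hypersurfaceMGHDRealised_realise` of the stub, registered for landing this helper.
[cite: Sbierski2016AHP, §2, Def. 2.4 and Remark (2)] -/
theorem stub_hypersurfaceMGHDRealised_realise :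
    ∀ {N : Type} [TopologicalSpace N] [ChartedSpace (EuclideanSpace ℝ (Fin 3)) N] [IsManifold (𝓡 3) ∞ N] [ConnectedSpace N] {D₁ : InitialDataSet (𝓡 3) N} (𝒰 𝒟₁ : CauchyDevelopment D₁) (𝒮₂ : Spacetime.{0} 4) (ι₂ : N → 𝒮₂.carrier) {j : 𝒰.carrier → 𝒟₁.carrier}, ContMDiff (𝓡 4) (𝓡 4) ∞ j → Topology.IsOpenEmbedding j → 𝒰.metric.IsIsometricImmersion 𝒟₁.metric.toPseudoRiemannianMetric j → 𝒰.timeOrientation.PreservesTimeOrientation j 𝒟₁.timeOrientation → j ∘ 𝒰.embed = 𝒟₁.embed → ∀ {k : 𝒰.carrier → 𝒮₂.carrier}, ContMDiff (𝓡 4) (𝓡 4) ∞ k → 𝒰.metric.IsIsometricImmersion 𝒮₂.metric.toPseudoRiemannianMetric k → 𝒰.timeOrientation.PreservesTimeOrientation k 𝒮₂.timeOrientation → k ∘ 𝒰.embed = ι₂ → Function.Injective k → ∃ (U : TopologicalSpace.Opens 𝒟₁.carrier) (ψ : 𝒟₁.carrier → 𝒮₂.carrier), ((∀ u, 𝒟₁.embed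 u ∈ U) ∧ IsConnected (U : Set 𝒟₁.carrier) ∧ (𝒟₁.metric.restrict PseudoRiemannianMetric.contMDiff_restrict_holds U).IsCauchyHypersurface (𝒟₁.timeOrientation.restrict PseudoRiemannianMetric.contMDiff_restrict_holds 𝒟₁.timeOrientation.contMDiff_restrict_holds U) (Subtype.val ⁻¹' Set.range 𝒟₁.embed) ∧ ContMDiffOn (𝓡 4) (𝓡 4) ∞ ψ U ∧ (∀ p ∈ U, pullbackBilin (I := 𝓡 4) (I' := 𝓡 4) ψ 𝒮₂.metric.val p = 𝒟₁.metric.val p) ∧ (∀ p ∈ U, 𝒮₂.timeOrientation.IsFutureDirected (mfderiv (𝓡 4) (𝓡 4) ψ p (𝒟₁.timeOrientation.vectorField p))) ∧ ψ ∘ 𝒟₁.embed = ι₂) ∧ (U : Set 𝒟₁.carrier) = Set.range j ∧ Set.InjOn ψ U ∧ ∀ x, ψ (j x) = k x :=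
  fun 𝒰 𝒟₁ 𝒮₂ ι₂ _ hjs hjo hji hjt hjc _ hks hki hkt hkc hkinj ↦
    exists_realised_into 𝒰 𝒟₁ 𝒮₂ ι₂ hjs hjo hji hjt hjc hks hki hkt hkc hkinj

end Summit.FinalStateConjecture.FinalStateConjecture.Theorems.CaptureSufficesC2.Sketch

end
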